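import Literature.Analysis.FluidPDE.LeiZhang2017SmallSwirlProof
import Summits.NavierStokesRegularity.NavierStokesRegularity.Theorems.CertifiedBlowupCertifiedBlowupAxisymBlowupSwirlPersists
import HarnessLib

/-!
# Witnesses of the crux `CertifiedBlowupAxisymBlowup` are never in the Lei–Zhang small-swirl regime

Theorems file landed `--supports stmt-NavierStokesRegularity-0727`, line `compact-amplification`
(continuation lead c2; bet route `SwirlThreshold`). Route `SwirlThreshold` brackets the swirl
threshold `Re_c` of the axisymmetric blow-up problem; its crux #2 `SmallSwirlRegularity` asks for an
ABSOLUTE lower bound, while print only has RELATIVE ones. The relative bound of Lei–Zhang 2017,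
Thm. 1.4 — global regularity when `‖Γ₀‖_{L^∞} ≤ δ M₀⁻¹`,
`M₀ = (‖ω₀^θ/r‖_{L²} + ‖(u₀^θ)²/r‖_{L²}) ‖Γ₀‖_{L²}`, `δ` absolute (`ν = 1`) — is a THEOREM of the
tree (`LeiZhang2017_smallSwirl_regularity_holds`). This file records its contrapositive at the crux,
kernel-checked: there is an absolute `δ > 0` such that the datum of EVERY unit-viscosity witness
whose data functionals are finite satisfies `‖Γ₀‖_{L^∞} > δ / M₀` — blow-up data never have small
swirl relative to `M₀` (`swirl_not_small_of_isMaximalSmoothSolution_one`, registered stub). Unit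
viscosity is no restriction by the landed normal form `certifiedBlowupAxisymBlowup_iff_forall_nu_T`.

No new definitions, no named-fact hypotheses, no `sorry`.

## References

* Z. Lei, Q. S. Zhang, *Criticality of the axially symmetric Navier–Stokes equations*, Pacific J.
  Math. 289 (2017), Thm. 1.4. [LeiZhang2017]
-/

-- the summit and its single problem share the name (D-0017 nested layout)
set_option linter.dupNamespace false

noncomputable section

open MeasureTheory Set Function Filter Topology Metric
open scoped ENNReal NNReal

namespace Summit.NavierStokesRegularity.NavierStokesRegularity.Theorems.CertifiedBlowupAxisymBlowup.CompactAmplification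

open Literature.Analysis.FluidPDE

/-- **Blow-up data never have small swirl relative to `M₀`** (registered stub of
stmt-NavierStokesRegularity-0727; contrapositive of Lei–Zhang 2017 Thm. 1.4 =
`LeiZhang2017_smallSwirl_regularity_holds` at the crux): there is an absolute `δ > 0` such that for
every maximal Leray–Hopf classical solution `(u, p)` of unit viscosity and finite lifespan `T` from a
rapidly decaying axisymmetric datum with `ω₀^θ/r`, `(u₀^θ)²/r`, `Γ₀ ∈ L²`, one has
`δ / M₀(u 0) < ‖Γ₀‖_{L^∞}` (in `[0, ∞]`). The axisymmetry of all slices required by the tree fact is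
`isAxisymmetric_slice_of_lerayHopf_classical`; `Γ₀ ∈ L^∞` is automatic
(`HasRapidSpatialDecay.eLpNorm_swirl_lt_top`). [cite: LeiZhang2017, Thm. 1.4] -/
theorem swirl_not_small_of_isMaximalSmoothSolution_one : ∃ δ : ℝ, 0 < δ ∧ ∀ {T : ℝ} {u : ℝ → EuclideanSpace ℝ (Fin 3) → EuclideanSpace ℝ (Fin 3)} {p : ℝ → EuclideanSpace ℝ (Fin 3) → ℝ}, 0 < T → IsMaximalSmoothSolution 1 0 u p T → IsLerayHopfOn T 1 0 (u 0) u → HasRapidSpatialDecay (u 0) → IsAxisymmetric (u 0) → eLpNorm (LeiZhang2017.bigOmega (u 0)) 2 volume < ⊤ → eLpNorm (LeiZhang2017.vSq (u 0)) 2 volume < ⊤ → eLpNorm (swirl (u 0)) 2 volume < ⊤ → ENNReal.ofReal δ / LeiZhang2017.M0 (u 0) < eLpNorm (swirl (u 0)) ⊤ volume := by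
  obtain ⟨δ, hδ, h⟩ := LeiZhang2017_smallSwirl_regularity_holds
  refine ⟨δ, hδ, fun {T u p} hT hmax hLH hdec haxi hΩ hV hΓ2 => ?_⟩
  by_contra hle
  rw [not_lt] at hle
  exact hmax.2 (h T u p hT hmax.1 hLH hdec
    (isAxisymmetric_slice_of_lerayHopf_classical one_pos hmax.1 hLH hdec haxi) hΩ hV hΓ2
    hdec.eLpNorm_swirl_lt_top hle)

end Summit.NavierStokesRegularity.NavierStokesRegularity.Theorems.CertifiedBlowupAxisymBlowup.CompactAmplification

end
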